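import Summits.QuantumFields.QCD.Theorems.WilsonMobilityGapMobilityGapChiralTransfer
import Summits.QuantumFields.QCD.Theorems.WilsonMobilityGapChiralMobilityGapPinOfLower

/-!
# Crux `ChiralMobilityGap` (stmt-QuantumFields-17497) — line `Sketch` (card `pin-rides-on-lower-clause`):
# the named predicates of the line and the TRANSFER `C⁺ → crux`

Proof-side definitions of the registered skeleton `Cruxes/ChiralMobilityGap/Lines/Sketch.lean` (lead
prover-line-stmt-QuantumFields-17497-0), kept out of proof files:

* `LowerWith reg m s c₀ C₁ p` — clause (iii) LOWER of the crux at the tuple `m` with its constants exposed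
  (`MobilityGapNegative.Lower reg m ↔ ∃ s c₀ C₁ p, 0 < s ∧ s < 1 ∧ 0 < c₀ ∧ LowerWith …`, `lower_iff`);
* `VanishingChiralRate reg` — for every `ε > 0` some degenerate positive tuple carries (iii) with physical
  rate `2C₁/s < ε` (the (iii)-rate vanishes with the renormalised mass: `m_crit` is the chiral line);
* `SuperLogVolume reg` — `a_k L_k / log(L_k+2) → ∞`;
* `pionWeight`, `PionWeightSignCoherent reg` (`N_f = 3`) — sign coherence of the pion-weighted determinant
  at the scheme's own side;
* `MobilityGapPlus` — `C⁺`: the verbatim clause package of the support `MobilityGap` (stmt-9150) with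
  vanishing chiral rate (`N_f = 2`), plus super-log volumes and the sign input (`N_f = 3`).

Theorems (pure logic over the landed first lemmas `stub_pinTwo` / `stub_pinThree` of
`…ChiralMobilityGapPinOfLower.lean`): `isChiralAtZero_two`, `isChiralAtZero_three`,
`pinned_of_mobilityGapPlus`, the TRANSFER `stub_transfer : MobilityGapPlus → ChiralMobilityGap` (registered
stub of the line), and the honesty record `mobilityGap_of_mobilityGapPlus : MobilityGapPlus → MobilityGap`
(`C⁺` contains the open support crux verbatim — it is NOT supplied here).
-/

noncomputable section

namespace Summit.QuantumFields.QCD.Theorems.ChiralMobilityGapSketch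

open scoped BigOperators Topology
open MeasureTheory Filter Set
open Literature.MathematicalPhysics.QuantumFieldTheory Literature.MathematicalPhysics.QuantumLattice
  Literature.Probability.LatticeModels
open Summit.QuantumFields.QCD.Theorems.MobilityGapNegative (bare fm Clauses Lower Sign)

variable {Nf : ℕ}

/-- Clause (iii) LOWER of the crux at the mass tuple `m` WITH ITS CONSTANTS EXPOSED: eventually in `k`,
on every torus `S ≥ L_k`, for every flavour and every `n ≤ S`,
`c₀ e^{-(C₁ a_k n + p log(n+1))} ≤ E₊[(Σ|G_f(0, n e₀)|)^s]`. -/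
def LowerWith (reg : QCDRegularisation Nf) (m : Fin Nf → ℝ) (s c₀ C₁ p : ℝ) : Prop :=
  ∀ᶠ k in atTop, ∀ S : ℕ, reg.L k ≤ S → ∀ (f : Fin Nf) (n : ℕ), n ≤ S →
    c₀ * Real.exp (-(C₁ * (reg.a k * n) + p * Real.log (n + 1))) ≤
      fm Nf (reg.β k) (bare reg m k) S f (Pi.single 0 (n : ℤ)) s

/-- `Lower` (clause (iii) of the support crux, verbatim) is `LowerWith` with the constants bound. -/
theorem lower_iff (reg : QCDRegularisation Nf) (m : Fin Nf → ℝ) :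
    Lower reg m ↔ ∃ s c₀ C₁ p : ℝ, 0 < s ∧ s < 1 ∧ 0 < c₀ ∧ LowerWith reg m s c₀ C₁ p :=
  Iff.rfl

/-- **Vanishing chiral rate**: for every `ε > 0` some DEGENERATE positive tuple `(t,…,t)` carries clause
(iii) with constants of physical rate `2C₁/s < ε` — the (iii)-rate tends to `0` with the renormalised
mass (`m_crit(k)` is the chiral critical line to `o(a_k/Z_m)`; physically `2C₁(t)/s ≈ m_π(t) ≈ √(2Bt)`). -/
def VanishingChiralRate (reg : QCDRegularisation Nf) : Prop :=
  ∀ ε > (0 : ℝ), ∃ t : ℝ, 0 < t ∧ ∃ s c₀ C₁ p : ℝ, 0 < s ∧ s < 1 ∧ 0 < c₀ ∧ 2 * C₁ < s * ε ∧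
    LowerWith reg (fun _ => t) s c₀ C₁ p

/-- **Super-logarithmic volumes**: `a_k L_k / log(L_k + 2) → ∞` (the physical side beats the logarithm of
the lattice side; free for a witness, since `L_k` is part of the data). Used only for `N_f = 3`. -/
def SuperLogVolume (reg : QCDRegularisation Nf) : Prop :=
  Tendsto (fun k => reg.a k * reg.L k / Real.log ((reg.L k : ℝ) + 2)) atTop atTop

/-- The **pion weight** at step `k` on the scheme's own torus (side `2L_k+1`), degenerate triple `(t,t,t)`:
`X_k(U) = Σ_{a,i,b,j} |G_0(U)((0,a,i),(L_k e₀,b,j))|²`. -/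
def pionWeight (reg : QCDRegularisation 3) (t : ℝ) (k : ℕ) (U : GaugeConfig 4 (2 * reg.L k + 1) SU3) : ℝ :=
  ∑ a : Fin 3, ∑ i : Fin 4, ∑ b : Fin 3, ∑ j : Fin 4,
    ‖(diracMatrix U (fun _ : Fin 3 => reg.mcrit k + reg.a k * t / reg.Zm k))⁻¹
        (quarkEquiv ((0 : Fin 3), (Torus.proj (2 * reg.L k + 1) 0, a, i)))
        (quarkEquiv ((0 : Fin 3), (Torus.proj (2 * reg.L k + 1) (Pi.single 0 (reg.L k : ℤ)), b, j)))‖ ^ (2 : ℕ)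

/-- **Sign coherence of the pion weight at the scheme's own side** (`N_f = 3`, the ONE sign input of the
line): for every `t > 0` there is `c > 0` with, eventually in `k`, on the torus of side `2L_k+1` at the
degenerate triple `(t,t,t)`, `c · ∫ |det D| X_k dμ_W ≤ |∫ det D · X_k dμ_W|`. -/
def PionWeightSignCoherent (reg : QCDRegularisation 3) : Prop :=
  ∀ t : ℝ, 0 < t → ∃ c : ℝ, 0 < c ∧ ∀ᶠ k in atTop,
    c * ∫ U : GaugeConfig 4 (2 * reg.L k + 1) SU3,
        ‖(diracMatrix U (fun _ : Fin 3 => reg.mcrit k + reg.a k * t / reg.Zm k)).det‖ * pionWeight reg t k U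
        ∂(wilsonMeasure (fundamentalRep (Fin 3)) (reg.β k)) ≤
      ‖∫ U : GaugeConfig 4 (2 * reg.L k + 1) SU3,
        (diracMatrix U (fun _ : Fin 3 => reg.mcrit k + reg.a k * t / reg.Zm k)).det * ((pionWeight reg t k U : ℝ) : ℂ)
        ∂(wilsonMeasure (fundamentalRep (Fin 3)) (reg.β k))‖

/-- **`C⁺` of the line** (`MobilityGapPlus`), split by the number of flavours. -/
def MobilityGapPlus : Prop :=
  (∃ reg : QCDRegularisation 2, Clauses 2 reg ∧ VanishingChiralRate reg) ∧
    (∃ reg : QCDRegularisation 3, Clauses 3 reg ∧ VanishingChiralRate reg ∧ SuperLogVolume reg ∧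
      PionWeightSignCoherent reg)

/-- `C⁺` contains the support crux `MobilityGap` (stmt-QuantumFields-9150) verbatim (honesty record: the
line supplies no mechanism for clauses (ii)–(iv); its content is the chiral pin). -/
theorem mobilityGap_of_mobilityGapPlus (h : MobilityGapPlus) :
    Summit.QuantumFields.QCD.Theses.WilsonMobilityGap.MobilityGap := by
  rw [MobilityGapNegative.mobilityGap_iff]
  intro Nf hNf
  rcases hNf with rfl | rfl
  · obtain ⟨reg, hC, -⟩ := h.1
    exact ⟨reg, hC⟩
  · obtain ⟨reg, hC, -⟩ := h.2
    exact ⟨reg, hC⟩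

/-- **The `N_f = 2` first lemma**: vanishing chiral rate implies the chiral pin (landed
`stub_pinTwo`, by unfolding). -/
theorem isChiralAtZero_two (reg : QCDRegularisation 2) (hV : VanishingChiralRate reg) : reg.IsChiralAtZero :=
  stub_pinTwo reg hV

/-- **The `N_f = 3` first lemma**: with the clause package (for (iv)), super-log volumes and the sign input,
vanishing chiral rate implies the chiral pin (landed `stub_pinThree`, by unfolding). -/
theorem isChiralAtZero_three (reg : QCDRegularisation 3) (hC : Clauses 3 reg) (hL : SuperLogVolume reg)
    (hσ : PionWeightSignCoherent reg) (hV : VanishingChiralRate reg) : reg.IsChiralAtZero :=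
  stub_pinThree reg (fun t ht => (hC.2.2 (fun _ => t) fun _ => ht).2.2.2) hL hσ hV

/-- **TRANSFER `C⁺ →` the pinned clause package** (the right-hand side of `chiralMobilityGap_iff`). -/
theorem pinned_of_mobilityGapPlus (h : MobilityGapPlus) :
    ∀ Nf : ℕ, Nf = 2 ∨ Nf = 3 → ∃ reg : QCDRegularisation Nf, reg.IsChiralAtZero ∧ Clauses Nf reg := by
  intro Nf hNf
  rcases hNf with rfl | rfl
  · obtain ⟨reg, hC, hV⟩ := h.1
    exact ⟨reg, isChiralAtZero_two reg hV, hC⟩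
  · obtain ⟨reg, hC, hV, hL, hσ⟩ := h.2
    exact ⟨reg, isChiralAtZero_three reg hC hL hσ hV, hC⟩

/-- **TRANSFER `C⁺ → crux`** (registered stub `stub_transfer` of the line): `MobilityGapPlus →
ChiralMobilityGap` (stmt-QuantumFields-17497) — `chiralMobilityGap_iff.2 ∘ pinned_of_mobilityGapPlus`.  What
remains of the crux after this line is exactly `MobilityGapPlus` (the support crux 9150 with vanishing chiral
rate, and for `N_f = 3` super-log volumes + pion-weight sign coherence). -/
theorem stub_transfer : MobilityGapPlus → Summit.QuantumFields.QCD.Theses.WilsonMobilityGap.ChiralMobilityGap :=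
  fun h => WilsonMobilityGap.chiralMobilityGap_iff.2 (pinned_of_mobilityGapPlus h)

end Summit.QuantumFields.QCD.Theorems.ChiralMobilityGapSketch

end
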